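import Mathlib
import Summits.Schanuel.Schanuel.Theorems.RigidCoreMinimalCounterexampleInAclHitSetArithmeticalRingDef

/-!
# Ring-definable families of real numbers: rational-cut ("box") arithmetic over `ℤ`
# (crux stmt-Schanuel-0969 `RigidCore.MinimalCounterexampleInAcl`, line kernel-arithmetic-selection, stub S8‴)

`--supports stmt-Schanuel-0969`; first foundation layer under the registered stub `stub_corankOne_hitSetRingDefinable`
(S8‴: the hit pattern `H_x ⊆ ℤ^m` of a corank-one first failure is `∅`-definable in the ring `ℤ`).

A family of real numbers `f : (σ → ℤ) → ℝ` indexed by integer tuples is called RING-DEFINABLE when its strict lower rational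
cut `{(v, p, r) : 0 < r ∧ p / r < f v} ⊆ ℤ^σ × ℤ²` is `∅`-definable in `(ℤ, +, ·)` (no new definitions are introduced — the cut
set is written out in every statement, with the family composed with the restriction `w ↦ (s ↦ w (inl s))` so that lemmas
chain by first-order unification).  This is the semantic form of "`f v` is an arithmetical real, uniformly in `v`".  This file proves the closure properties that make computable analysis available inside first-order
arithmetic WITHOUT any coding of real numbers:

* quotients of definable integer functions (`defR_ratio`), reindexing (`defR_reindex`);
* sums, negation, differences, finite sums (`defR_add`, `defR_neg`, `defR_sub`, `defR_sum`); products (through the four corner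
  products of a rational box, whence the name) are in the companion `…HitSetBoxArithComplex.lean`;
* comparison: `{v | f v < g v}`, `{v | f v ≤ g v}` are ring-definable (`ringDefinable_setOf_realLt/realLe`);
* LIMITS: a pointwise limit along `ℕ` of a ring-definable family is ring-definable (`defR_limit`) — one more number quantifier,
  no rate of convergence needed (this is where definability is cheaper than computability).

Registered helper stub: `ringDefinable_realCut_add` (the sum rule, explicit form).

References: K. Weihrauch, *Computable Analysis* (2000), §4.1 (rational cuts / interval representations); H. Rogers, *Theory of
Recursive Functions and Effective Computability* (1967), §14.1, §15.1 (arithmetical sets and arithmetical reals).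
-/

-- the summit namespace `Summit.Schanuel.Schanuel.…` repeats a component by design (D-0022)
set_option linter.dupNamespace false

open Set FirstOrder FirstOrder.Language Filter Topology

namespace Summit.Schanuel.Schanuel.Cruxes.MinimalCounterexampleInAcl.KernelArithmeticSelection

open Literature.ModelTheory.ExponentialFields

/-! ## Elementary facts about rationals as integer quotients -/

/-- Between two reals there is `p / r` with integers `p` and `0 < r`. -/
theorem exists_int_div_btwn {a b : ℝ} (h : a < b) : ∃ p r : ℤ, 0 < r ∧ a < (p : ℝ) / r ∧ (p : ℝ) / r < b := by
  obtain ⟨q, hq1, hq2⟩ := exists_rat_btwn h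
  refine ⟨q.num, q.den, by exact_mod_cast q.den_pos, ?_, ?_⟩ <;>
  · have : ((q.num : ℝ) / (q.den : ℤ)) = (q : ℝ) := by
      rw [Int.cast_natCast]; exact_mod_cast q.num_div_den
    rw [this]; assumption

/-- Sign analysis of `p < r · (n / d)` over `ℝ` for integers. -/
theorem int_lt_mul_div_iff (p r n d : ℤ) :
    (p : ℝ) < r * ((n : ℝ) / d) ↔ (0 < d ∧ p * d < r * n) ∨ (d < 0 ∧ r * n < p * d) ∨ (d = 0 ∧ p < 0) := by
  rw [← mul_div_assoc]
  rcases lt_trichotomy d 0 with hd | hd | hd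
  · have hd' : (d : ℝ) < 0 := by exact_mod_cast hd
    rw [lt_div_iff_of_neg hd']
    constructor
    · intro h; exact Or.inr (Or.inl ⟨hd, by exact_mod_cast h⟩)
    · rintro (⟨h1, -⟩ | ⟨-, h2⟩ | ⟨h3, -⟩)
      · omega
      · exact_mod_cast h2
      · omega
  · subst hd
    rw [Int.cast_zero, div_zero]
    constructor
    · intro h; exact Or.inr (Or.inr ⟨rfl, by exact_mod_cast h⟩)
    · rintro (⟨h1, -⟩ | ⟨h2, -⟩ | ⟨-, h3⟩)
      · exact absurd h1 (lt_irrefl _)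
      · exact absurd h2 (lt_irrefl _)
      · exact_mod_cast h3
  · have hd' : (0 : ℝ) < d := by exact_mod_cast hd
    rw [lt_div_iff₀ hd']
    constructor
    · intro h; exact Or.inl ⟨hd, by exact_mod_cast h⟩
    · rintro (⟨-, h1⟩ | ⟨h2, -⟩ | ⟨h3, -⟩)
      · exact_mod_cast h1
      · omega
      · omega

/-- `p / r < a` for integers `p`, `0 < r` iff `p < r · a`. -/
theorem int_div_lt_iff {p r : ℤ} (hr : 0 < r) (a : ℝ) : (p : ℝ) / r < a ↔ (p : ℝ) < r * a := by
  rw [div_lt_iff₀ (by exact_mod_cast hr : (0 : ℝ) < r), mul_comm]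

variable [FirstOrder.Ring.CompatibleRing ℤ] {σ τ : Type*}

/-! ## Atoms: reindexing, quotients of definable integer functions -/

/-- Ring-definability of a real family depends only on its values. -/
theorem defR_congr {f g : (σ → ℤ) → ℝ} (hf : (∅ : Set ℤ).Definable Language.ring {w : _ ⊕ Fin 2 → ℤ | 0 < w (Sum.inr 1) ∧ ((w (Sum.inr 0) : ℤ) : ℝ) < ((w (Sum.inr 1) : ℤ) : ℝ) * (f ∘ fun w' s => w' (Sum.inl s)) w}) (h : ∀ v, f v = g v) : (∅ : Set ℤ).Definable Language.ring {w : _ ⊕ Fin 2 → ℤ | 0 < w (Sum.inr 1) ∧ ((w (Sum.inr 0) : ℤ) : ℝ) < ((w (Sum.inr 1) : ℤ) : ℝ) * (g ∘ fun w' s => w' (Sum.inl s)) w} := by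
  have e : f = g := funext h
  subst e; exact hf

/-- Reindexing a ring-definable real family along a map of parameter types. [folklore] -/
theorem defR_reindex {f : (σ → ℤ) → ℝ} (hf : (∅ : Set ℤ).Definable Language.ring {w : _ ⊕ Fin 2 → ℤ | 0 < w (Sum.inr 1) ∧ ((w (Sum.inr 0) : ℤ) : ℝ) < ((w (Sum.inr 1) : ℤ) : ℝ) * (f ∘ fun w' s => w' (Sum.inl s)) w}) (ρ : σ → τ) :
    (∅ : Set ℤ).Definable Language.ring {w : _ ⊕ Fin 2 → ℤ | 0 < w (Sum.inr 1) ∧ ((w (Sum.inr 0) : ℤ) : ℝ) < ((w (Sum.inr 1) : ℤ) : ℝ) * ((fun u : τ → ℤ => f (fun s => u (ρ s))) ∘ fun w' s => w' (Sum.inl s)) w} :=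
  hf.preimage_comp (Sum.map ρ (id : Fin 2 → Fin 2))

/-- The cut of a ring-definable real family read at reindexed parameters and at two coordinates `i`, `j` of a bigger tuple
(the atom used under quantifier blocks). [folklore] -/
theorem defR_atom {f : (σ → ℤ) → ℝ} (hf : (∅ : Set ℤ).Definable Language.ring {w : _ ⊕ Fin 2 → ℤ | 0 < w (Sum.inr 1) ∧ ((w (Sum.inr 0) : ℤ) : ℝ) < ((w (Sum.inr 1) : ℤ) : ℝ) * (f ∘ fun w' s => w' (Sum.inl s)) w}) (ρ : σ → τ) (i j : τ) :
    (∅ : Set ℤ).Definable Language.ring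
      {u : τ → ℤ | 0 < u j ∧ ((u i : ℤ) : ℝ) < ((u j : ℤ) : ℝ) * f (fun s => u (ρ s))} := by
  have h := hf.preimage_comp (Sum.elim ρ ![i, j])
  convert h using 1
  ext u
  simp only [mem_setOf_eq, mem_preimage, Function.comp_apply, Sum.elim_inl, Sum.elim_inr, Matrix.cons_val_zero,
    Matrix.cons_val_one]

/-- The cut atom with the parameter substitution written as an arbitrary map `π` that is pointwise a reindexing (this is the
form produced under quantifier blocks, where the tuple is reassembled with `Sum.elim`). [folklore] -/
theorem defR_atom' {f : (σ → ℤ) → ℝ} (hf : (∅ : Set ℤ).Definable Language.ring {w : _ ⊕ Fin 2 → ℤ | 0 < w (Sum.inr 1) ∧ ((w (Sum.inr 0) : ℤ) : ℝ) < ((w (Sum.inr 1) : ℤ) : ℝ) * (f ∘ fun w' s => w' (Sum.inl s)) w}) (ρ : σ → τ) (i j : τ) {π : (τ → ℤ) → σ → ℤ}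
    (hπ : ∀ u, π u = fun s => u (ρ s)) :
    (∅ : Set ℤ).Definable Language.ring
      {u : τ → ℤ | 0 < u j ∧ ((u i : ℤ) : ℝ) < ((u j : ℤ) : ℝ) * f (π u)} := by
  simp only [hπ]
  exact defR_atom hf ρ i j

/-- A quotient of ring-definable integer functions is a ring-definable real family (sign analysis of the denominator;
`n / 0 = 0`). [folklore] -/
theorem defR_ratio {N D : (σ → ℤ) → ℤ} (hN : (∅ : Set ℤ).DefinableFun Language.ring N)
    (hD : (∅ : Set ℤ).DefinableFun Language.ring D) :
    (∅ : Set ℤ).Definable Language.ring {w : _ ⊕ Fin 2 → ℤ | 0 < w (Sum.inr 1) ∧ ((w (Sum.inr 0) : ℤ) : ℝ) < ((w (Sum.inr 1) : ℤ) : ℝ) * ((fun v => (N v : ℝ) / (D v : ℝ)) ∘ fun w' s => w' (Sum.inl s)) w} := by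
  have hN' := definableFun_reindex hN (Sum.inl : σ → σ ⊕ Fin 2)
  have hD' := definableFun_reindex hD (Sum.inl : σ → σ ⊕ Fin 2)
  have h : (∅ : Set ℤ).Definable Language.ring {w : σ ⊕ Fin 2 → ℤ | 0 < w (Sum.inr 1) ∧
      ((0 < D (fun s => w (Sum.inl s)) ∧ w (Sum.inr 0) * D (fun s => w (Sum.inl s)) < w (Sum.inr 1) * N (fun s => w (Sum.inl s))) ∨
       (D (fun s => w (Sum.inl s)) < 0 ∧ w (Sum.inr 1) * N (fun s => w (Sum.inl s)) < w (Sum.inr 0) * D (fun s => w (Sum.inl s))) ∨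
       (D (fun s => w (Sum.inl s)) = 0 ∧ w (Sum.inr 0) < 0))} :=
    definable_setOf_and_params (ringDefinable_setOf_lt ringDefinableFun_zero (definableFun_proj_params _))
      (definable_setOf_or_params
        (definable_setOf_and_params (ringDefinable_setOf_lt ringDefinableFun_zero hD')
          (ringDefinable_setOf_lt (ringDefinableFun_mul (definableFun_proj_params _) hD')
            (ringDefinableFun_mul (definableFun_proj_params _) hN')))
        (definable_setOf_or_params
          (definable_setOf_and_params (ringDefinable_setOf_lt hD' ringDefinableFun_zero)
            (ringDefinable_setOf_lt (ringDefinableFun_mul (definableFun_proj_params _) hN')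
              (ringDefinableFun_mul (definableFun_proj_params _) hD')))
          (definable_setOf_and_params (definable_setOf_eq_params hD' ringDefinableFun_zero)
            (ringDefinable_setOf_lt (definableFun_proj_params _) ringDefinableFun_zero))))
  convert h using 1
  ext w
  simp only [mem_setOf_eq, Function.comp_apply]
  exact and_congr_right fun _ => int_lt_mul_div_iff _ _ _ _

/-- An integer-valued ring-definable function is a ring-definable real family. [folklore] -/
theorem defR_intCast {N : (σ → ℤ) → ℤ} (hN : (∅ : Set ℤ).DefinableFun Language.ring N) :
    (∅ : Set ℤ).Definable Language.ring {w : _ ⊕ Fin 2 → ℤ | 0 < w (Sum.inr 1) ∧ ((w (Sum.inr 0) : ℤ) : ℝ) < ((w (Sum.inr 1) : ℤ) : ℝ) * ((fun v => (N v : ℝ)) ∘ fun w' s => w' (Sum.inl s)) w} := by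
  have h := defR_ratio hN ringDefinableFun_one
  simpa using h

/-- A rational constant is a ring-definable real family. [folklore] -/
theorem defR_ratCast (q : ℚ) : (∅ : Set ℤ).Definable Language.ring {w : _ ⊕ Fin 2 → ℤ | 0 < w (Sum.inr 1) ∧ ((w (Sum.inr 0) : ℤ) : ℝ) < ((w (Sum.inr 1) : ℤ) : ℝ) * ((fun _ : σ → ℤ => (q : ℝ)) ∘ fun w' s => w' (Sum.inl s)) w} := by
  have h := defR_ratio (ringDefinableFun_intCast (α := σ) q.num) (ringDefinableFun_intCast (α := σ) q.den)
  have e : (fun _ : σ → ℤ => (q : ℝ)) = fun _ => ((q.num : ℤ) : ℝ) / ((q.den : ℤ) : ℝ) := by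
    funext v; rw [Rat.cast_def, Int.cast_natCast]
  rw [e]; exact h

/-! ## Comparison -/

/-- `{v | f v < g v}` is ring-definable for ring-definable real families (`f < g ↔ ∃ t ∈ ℚ, f ≤ t < g`). [folklore] -/
theorem ringDefinable_setOf_realLt {f g : (σ → ℤ) → ℝ} (hf : (∅ : Set ℤ).Definable Language.ring {w : _ ⊕ Fin 2 → ℤ | 0 < w (Sum.inr 1) ∧ ((w (Sum.inr 0) : ℤ) : ℝ) < ((w (Sum.inr 1) : ℤ) : ℝ) * (f ∘ fun w' s => w' (Sum.inl s)) w}) (hg : (∅ : Set ℤ).Definable Language.ring {w : _ ⊕ Fin 2 → ℤ | 0 < w (Sum.inr 1) ∧ ((w (Sum.inr 0) : ℤ) : ℝ) < ((w (Sum.inr 1) : ℤ) : ℝ) * (g ∘ fun w' s => w' (Sum.inl s)) w}) :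
    (∅ : Set ℤ).Definable Language.ring {v : σ → ℤ | f v < g v} := by
  have h : (∅ : Set ℤ).Definable Language.ring {v : σ → ℤ | ∃ u : Fin 2 → ℤ,
      ¬ (0 < u 1 ∧ ((u 0 : ℤ) : ℝ) < ((u 1 : ℤ) : ℝ) * f v) ∧ (0 < u 1 ∧ ((u 0 : ℤ) : ℝ) < ((u 1 : ℤ) : ℝ) * g v)} :=
    definable_setOf_existsBlock (definable_setOf_and_params
      (definable_setOf_not_params (defR_atom hf Sum.inl (Sum.inr 0) (Sum.inr 1)))
      (defR_atom hg Sum.inl (Sum.inr 0) (Sum.inr 1)))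
  convert h using 1
  ext v
  simp only [mem_setOf_eq]
  constructor
  · intro hlt
    obtain ⟨p, r, hr, h1, h2⟩ := exists_int_div_btwn hlt
    refine ⟨![p, r], fun ⟨_, h⟩ => ?_, hr, ?_⟩
    · simp only [Matrix.cons_val_zero, Matrix.cons_val_one] at h
      rw [← int_div_lt_iff hr] at h; linarith
    · simp only [Matrix.cons_val_zero, Matrix.cons_val_one]
      rwa [← int_div_lt_iff hr]
  · rintro ⟨u, h1, hr, h2⟩
    have h1' : ¬ ((u 0 : ℤ) : ℝ) < ((u 1 : ℤ) : ℝ) * f v := fun h => h1 ⟨hr, h⟩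
    rw [← int_div_lt_iff hr] at h1' h2
    linarith [not_lt.1 h1']

/-- `{v | f v ≤ g v}` is ring-definable for ring-definable real families. [folklore] -/
theorem ringDefinable_setOf_realLe {f g : (σ → ℤ) → ℝ} (hf : (∅ : Set ℤ).Definable Language.ring {w : _ ⊕ Fin 2 → ℤ | 0 < w (Sum.inr 1) ∧ ((w (Sum.inr 0) : ℤ) : ℝ) < ((w (Sum.inr 1) : ℤ) : ℝ) * (f ∘ fun w' s => w' (Sum.inl s)) w}) (hg : (∅ : Set ℤ).Definable Language.ring {w : _ ⊕ Fin 2 → ℤ | 0 < w (Sum.inr 1) ∧ ((w (Sum.inr 0) : ℤ) : ℝ) < ((w (Sum.inr 1) : ℤ) : ℝ) * (g ∘ fun w' s => w' (Sum.inl s)) w}) :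
    (∅ : Set ℤ).Definable Language.ring {v : σ → ℤ | f v ≤ g v} := by
  have h := (ringDefinable_setOf_realLt hg hf).compl
  convert h using 1
  ext v; simp

/-! ## Sums, negation, products -/

/-- Sums of ring-definable real families are ring-definable (`p/r < f + g ↔ ∃ p₁/r₁ < f, p₂/r₂ < g, p/r ≤ p₁/r₁ + p₂/r₂`).
[folklore] -/
theorem defR_add {f g : (σ → ℤ) → ℝ} (hf : (∅ : Set ℤ).Definable Language.ring {w : _ ⊕ Fin 2 → ℤ | 0 < w (Sum.inr 1) ∧ ((w (Sum.inr 0) : ℤ) : ℝ) < ((w (Sum.inr 1) : ℤ) : ℝ) * (f ∘ fun w' s => w' (Sum.inl s)) w}) (hg : (∅ : Set ℤ).Definable Language.ring {w : _ ⊕ Fin 2 → ℤ | 0 < w (Sum.inr 1) ∧ ((w (Sum.inr 0) : ℤ) : ℝ) < ((w (Sum.inr 1) : ℤ) : ℝ) * (g ∘ fun w' s => w' (Sum.inl s)) w}) : (∅ : Set ℤ).Definable Language.ring {w : _ ⊕ Fin 2 → ℤ | 0 < w (Sum.inr 1) ∧ ((w (Sum.inr 0) : ℤ) : ℝ) < ((w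 (Sum.inr 1) : ℤ) : ℝ) * ((fun v => f v + g v) ∘ fun w' s => w' (Sum.inl s)) w} := by
  have h : (∅ : Set ℤ).Definable Language.ring {w : σ ⊕ Fin 2 → ℤ | 0 < w (Sum.inr 1) ∧ ∃ u : Fin 4 → ℤ,
      (0 < u 1 ∧ ((u 0 : ℤ) : ℝ) < ((u 1 : ℤ) : ℝ) * f (fun s => w (Sum.inl s))) ∧
      (0 < u 3 ∧ ((u 2 : ℤ) : ℝ) < ((u 3 : ℤ) : ℝ) * g (fun s => w (Sum.inl s))) ∧
      w (Sum.inr 0) * u 1 * u 3 ≤ w (Sum.inr 1) * (u 0 * u 3 + u 1 * u 2)} := by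
    refine definable_setOf_and_params (ringDefinable_setOf_lt ringDefinableFun_zero (definableFun_proj_params _))
      (definable_setOf_existsBlock (definable_setOf_and_params ?_ (definable_setOf_and_params ?_ ?_)))
    · exact defR_atom hf (fun s => Sum.inl (Sum.inl s)) (Sum.inr 0) (Sum.inr 1)
    · exact defR_atom hg (fun s => Sum.inl (Sum.inl s)) (Sum.inr 2) (Sum.inr 3)
    · exact ringDefinable_setOf_le
        (ringDefinableFun_mul (ringDefinableFun_mul (definableFun_proj_params _) (definableFun_proj_params _))
          (definableFun_proj_params _))
        (ringDefinableFun_mul (definableFun_proj_params _) (ringDefinableFun_add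
          (ringDefinableFun_mul (definableFun_proj_params _) (definableFun_proj_params _))
          (ringDefinableFun_mul (definableFun_proj_params _) (definableFun_proj_params _))))
  convert h using 1
  ext w
  simp only [mem_setOf_eq, Function.comp_apply]
  refine and_congr_right fun hr => ?_
  set p := w (Sum.inr 0)
  set r := w (Sum.inr 1)
  set a := f (fun s => w (Sum.inl s))
  set b := g (fun s => w (Sum.inl s))
  have hr' : (0 : ℝ) < r := by exact_mod_cast hr
  constructor
  · intro hlt
    rw [← int_div_lt_iff hr] at hlt
    obtain ⟨p₁, r₁, hr₁, h₁, h₁'⟩ := exists_int_div_btwn (show a - (a + b - p / r) / 2 < a by linarith)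
    obtain ⟨p₂, r₂, hr₂, h₂, h₂'⟩ := exists_int_div_btwn (show b - (a + b - p / r) / 2 < b by linarith)
    refine ⟨![p₁, r₁, p₂, r₂], ⟨hr₁, ?_⟩, ⟨hr₂, ?_⟩, ?_⟩
    · simp only [Matrix.cons_val_zero, Matrix.cons_val_one]; rwa [← int_div_lt_iff hr₁]
    · simp only [Matrix.cons_val]; rwa [← int_div_lt_iff hr₂]
    · simp only [Matrix.cons_val_zero, Matrix.cons_val_one, Matrix.cons_val]
      have hr₁' : (0 : ℝ) < r₁ := by exact_mod_cast hr₁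
      have hr₂' : (0 : ℝ) < r₂ := by exact_mod_cast hr₂
      have key : (p : ℝ) / r ≤ (p₁ * r₂ + r₁ * p₂) / (r₁ * r₂) := by
        rw [← div_add_div _ _ hr₁'.ne' hr₂'.ne']; linarith
      rw [div_le_div_iff₀ hr' (mul_pos hr₁' hr₂')] at key
      exact_mod_cast (by linarith : (p : ℝ) * r₁ * r₂ ≤ r * (p₁ * r₂ + r₁ * p₂))
  · rintro ⟨u, ⟨hr₁, h₁⟩, ⟨hr₂, h₂⟩, hle⟩
    rw [← int_div_lt_iff hr₁] at h₁
    rw [← int_div_lt_iff hr₂] at h₂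
    rw [← int_div_lt_iff hr]
    have hr₁' : (0 : ℝ) < u 1 := by exact_mod_cast hr₁
    have hr₂' : (0 : ℝ) < u 3 := by exact_mod_cast hr₂
    have hle' : (p : ℝ) * u 1 * u 3 ≤ r * (u 0 * u 3 + u 1 * u 2) := by exact_mod_cast hle
    have key : (p : ℝ) / r ≤ (u 0 * u 3 + u 1 * u 2) / (u 1 * u 3) := by
      rw [div_le_div_iff₀ hr' (mul_pos hr₁' hr₂')]; linarith
    rw [← div_add_div _ _ hr₁'.ne' hr₂'.ne'] at key
    linarith

/-- Negations of ring-definable real families are ring-definable (`p/r < -f ↔ ∃ t ∈ ℚ, f ≤ t < -p/r`). [folklore] -/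
theorem defR_neg {f : (σ → ℤ) → ℝ} (hf : (∅ : Set ℤ).Definable Language.ring {w : _ ⊕ Fin 2 → ℤ | 0 < w (Sum.inr 1) ∧ ((w (Sum.inr 0) : ℤ) : ℝ) < ((w (Sum.inr 1) : ℤ) : ℝ) * (f ∘ fun w' s => w' (Sum.inl s)) w}) : (∅ : Set ℤ).Definable Language.ring {w : _ ⊕ Fin 2 → ℤ | 0 < w (Sum.inr 1) ∧ ((w (Sum.inr 0) : ℤ) : ℝ) < ((w (Sum.inr 1) : ℤ) : ℝ) * ((fun v => -f v) ∘ fun w' s => w' (Sum.inl s)) w} := by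
  have h : (∅ : Set ℤ).Definable Language.ring {w : σ ⊕ Fin 2 → ℤ | 0 < w (Sum.inr 1) ∧ ∃ u : Fin 2 → ℤ,
      ¬ (0 < u 1 ∧ ((u 0 : ℤ) : ℝ) < ((u 1 : ℤ) : ℝ) * f (fun s => w (Sum.inl s))) ∧ 0 < u 1 ∧
      u 0 * w (Sum.inr 1) + w (Sum.inr 0) * u 1 < 0} := by
    refine definable_setOf_and_params (ringDefinable_setOf_lt ringDefinableFun_zero (definableFun_proj_params _))
      (definable_setOf_existsBlock (definable_setOf_and_params ?_ (definable_setOf_and_params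
        (ringDefinable_setOf_lt ringDefinableFun_zero (definableFun_proj_params _)) ?_)))
    · exact definable_setOf_not_params (defR_atom hf (fun s => Sum.inl (Sum.inl s)) (Sum.inr 0) (Sum.inr 1))
    · exact ringDefinable_setOf_lt (ringDefinableFun_add
        (ringDefinableFun_mul (definableFun_proj_params _) (definableFun_proj_params _))
        (ringDefinableFun_mul (definableFun_proj_params _) (definableFun_proj_params _))) ringDefinableFun_zero
  convert h using 1
  ext w
  simp only [mem_setOf_eq, Function.comp_apply]
  refine and_congr_right fun hr => ?_
  set p := w (Sum.inr 0)
  set r := w (Sum.inr 1)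
  set a := f (fun s => w (Sum.inl s))
  have hr' : (0 : ℝ) < r := by exact_mod_cast hr
  constructor
  · intro hlt
    rw [← int_div_lt_iff hr] at hlt
    obtain ⟨p₁, r₁, hr₁, h₁, h₁'⟩ := exists_int_div_btwn (show a < -(p / r) by linarith)
    have hr₁' : (0 : ℝ) < r₁ := by exact_mod_cast hr₁
    refine ⟨![p₁, r₁], fun ⟨_, h⟩ => ?_, hr₁, ?_⟩
    · simp only [Matrix.cons_val_zero, Matrix.cons_val_one] at h
      rw [← int_div_lt_iff hr₁] at h; linarith
    · simp only [Matrix.cons_val_zero, Matrix.cons_val_one]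
      rw [← neg_div, div_lt_div_iff₀ hr₁' hr'] at h₁'
      exact_mod_cast (by linarith : (p₁ : ℝ) * r + p * r₁ < 0)
  · rintro ⟨u, h₁, hr₁, hlt⟩
    have hr₁' : (0 : ℝ) < u 1 := by exact_mod_cast hr₁
    have h₁' : ¬ ((u 0 : ℤ) : ℝ) < ((u 1 : ℤ) : ℝ) * a := fun h => h₁ ⟨hr₁, h⟩
    rw [← int_div_lt_iff hr₁, not_lt] at h₁'
    rw [← int_div_lt_iff hr]
    have hlt' : (u 0 : ℝ) * r + p * u 1 < 0 := by exact_mod_cast hlt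
    have key : (u 0 : ℝ) / u 1 < -(p / r) := by
      rw [← neg_div, div_lt_div_iff₀ hr₁' hr']; linarith
    linarith

/-- Differences of ring-definable real families are ring-definable. [folklore] -/
theorem defR_sub {f g : (σ → ℤ) → ℝ} (hf : (∅ : Set ℤ).Definable Language.ring {w : _ ⊕ Fin 2 → ℤ | 0 < w (Sum.inr 1) ∧ ((w (Sum.inr 0) : ℤ) : ℝ) < ((w (Sum.inr 1) : ℤ) : ℝ) * (f ∘ fun w' s => w' (Sum.inl s)) w}) (hg : (∅ : Set ℤ).Definable Language.ring {w : _ ⊕ Fin 2 → ℤ | 0 < w (Sum.inr 1) ∧ ((w (Sum.inr 0) : ℤ) : ℝ) < ((w (Sum.inr 1) : ℤ) : ℝ) * (g ∘ fun w' s => w' (Sum.inl s)) w}) : (∅ : Set ℤ).Definable Language.ring {w : _ ⊕ Fin 2 → ℤ | 0 < w (Sum.inr 1) ∧ ((w (Sum.inr 0) : ℤ) : ℝ) < ((w (Sum.inr 1) : ℤ) : ℝ) * ((fun v => f v - g v) ∘ fun w' s => w' (Sum.inl s)) w} :=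
  defR_congr (defR_add hf (defR_neg hg)) fun v => by ring

/-- Finite sums of ring-definable real families are ring-definable. [folklore] -/
theorem defR_sum {ι : Type*} (s : Finset ι) {F : ι → (σ → ℤ) → ℝ} (hF : ∀ i ∈ s, (∅ : Set ℤ).Definable Language.ring {w : _ ⊕ Fin 2 → ℤ | 0 < w (Sum.inr 1) ∧ ((w (Sum.inr 0) : ℤ) : ℝ) < ((w (Sum.inr 1) : ℤ) : ℝ) * ((F i) ∘ fun w' s => w' (Sum.inl s)) w}) :
    (∅ : Set ℤ).Definable Language.ring {w : _ ⊕ Fin 2 → ℤ | 0 < w (Sum.inr 1) ∧ ((w (Sum.inr 0) : ℤ) : ℝ) < ((w (Sum.inr 1) : ℤ) : ℝ) * ((fun v => ∑ i ∈ s, F i v) ∘ fun w' s => w' (Sum.inl s)) w} := by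
  classical
  induction s using Finset.induction_on with
  | empty => exact defR_congr (defR_intCast (ringDefinableFun_zero (α := σ))) fun v => by simp
  | insert i s hi ih =>
    exact defR_congr (defR_add (hF i (Finset.mem_insert_self i s))
      (ih fun j hj => hF j (Finset.mem_insert_of_mem hj))) fun v => by simp [Finset.sum_insert hi]

/-! ## Limits -/

/-- **A pointwise limit of a ring-definable family is ring-definable**: if `g (v, n) → f v` as `n → ∞` then
`p/r < f v ↔ ∃ P/R > p/r, ∃ n₀, ∀ n ≥ n₀, P/R < g (v, n)` — two more number quantifiers, no modulus of convergence. [folklore] -/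
theorem defR_limit {g : (σ ⊕ Unit → ℤ) → ℝ} (hg : (∅ : Set ℤ).Definable Language.ring {w : _ ⊕ Fin 2 → ℤ | 0 < w (Sum.inr 1) ∧ ((w (Sum.inr 0) : ℤ) : ℝ) < ((w (Sum.inr 1) : ℤ) : ℝ) * (g ∘ fun w' s => w' (Sum.inl s)) w}) {f : (σ → ℤ) → ℝ}
    (hlim : ∀ v : σ → ℤ, Tendsto (fun n : ℕ => g (Sum.elim v (fun _ => (n : ℤ)))) atTop (𝓝 (f v))) : (∅ : Set ℤ).Definable Language.ring {w : _ ⊕ Fin 2 → ℤ | 0 < w (Sum.inr 1) ∧ ((w (Sum.inr 0) : ℤ) : ℝ) < ((w (Sum.inr 1) : ℤ) : ℝ) * (f ∘ fun w' s => w' (Sum.inl s)) w} := by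
  have h : (∅ : Set ℤ).Definable Language.ring {w : σ ⊕ Fin 2 → ℤ | 0 < w (Sum.inr 1) ∧ ∃ u : Fin 2 → ℤ,
      0 < u 1 ∧ w (Sum.inr 0) * u 1 < w (Sum.inr 1) * u 0 ∧ ∃ n₀ : ℤ, ∀ n : ℤ, n₀ ≤ n → 0 ≤ n →
        (0 < u 1 ∧ ((u 0 : ℤ) : ℝ) < ((u 1 : ℤ) : ℝ) * g (fun s => Sum.elim (fun s' => w (Sum.inl s')) (fun _ => n) s))} := by
    refine definable_setOf_and_params (ringDefinable_setOf_lt ringDefinableFun_zero (definableFun_proj_params _))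
      (definable_setOf_existsBlock (definable_setOf_and_params
        (ringDefinable_setOf_lt ringDefinableFun_zero (definableFun_proj_params _))
        (definable_setOf_and_params (ringDefinable_setOf_lt
          (ringDefinableFun_mul (definableFun_proj_params _) (definableFun_proj_params _))
          (ringDefinableFun_mul (definableFun_proj_params _) (definableFun_proj_params _)))
        (definable_setOf_exists_params (definable_setOf_forall_params (definable_setOf_imp_params
          (ringDefinable_setOf_le (definableFun_proj_params _) (definableFun_proj_params _))
          (definable_setOf_imp_params (ringDefinable_setOf_nonneg (definableFun_proj_params _)) ?_)))))))
    exact defR_atom' hg (Sum.elim (fun s => Sum.inl (Sum.inl (Sum.inl (Sum.inl s)))) (fun _ => Sum.inr ()))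
      (Sum.inl (Sum.inl (Sum.inr 0))) (Sum.inl (Sum.inl (Sum.inr 1))) (fun u => funext fun s => by cases s <;> rfl)
  convert h using 1
  ext w
  simp only [mem_setOf_eq, Function.comp_apply]
  refine and_congr_right fun hr => ?_
  set p := w (Sum.inr 0)
  set r := w (Sum.inr 1)
  set v : σ → ℤ := fun s => w (Sum.inl s)
  have hr' : (0 : ℝ) < r := by exact_mod_cast hr
  constructor
  · intro hlt
    rw [← int_div_lt_iff hr] at hlt
    obtain ⟨P, R, hR, h1, h2⟩ := exists_int_div_btwn hlt
    have hR' : (0 : ℝ) < R := by exact_mod_cast hR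
    have hev := (hlim v).eventually_const_lt h2
    rw [eventually_atTop] at hev
    obtain ⟨n₀, hn₀⟩ := hev
    refine ⟨![P, R], hR, ?_, n₀, fun n hn hn0 => ⟨hR, ?_⟩⟩
    · simp only [Matrix.cons_val_zero, Matrix.cons_val_one]
      rw [div_lt_div_iff₀ hr' hR'] at h1
      exact_mod_cast (by linarith : (p : ℝ) * R < r * P)
    · simp only [Matrix.cons_val_zero, Matrix.cons_val_one]
      rw [← int_div_lt_iff hR]
      obtain ⟨k, rfl⟩ := Int.eq_ofNat_of_zero_le hn0
      exact hn₀ k (by exact_mod_cast hn)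
  · rintro ⟨u, hR, hPR, n₀, hn₀⟩
    have hR' : (0 : ℝ) < u 1 := by exact_mod_cast hR
    rw [← int_div_lt_iff hr]
    have hPR' : (p : ℝ) * u 1 < r * u 0 := by exact_mod_cast hPR
    have h1 : (p : ℝ) / r < (u 0 : ℝ) / u 1 := by rw [div_lt_div_iff₀ hr' hR']; linarith
    refine h1.trans_le (ge_of_tendsto (hlim v) ?_)
    rw [eventually_atTop]
    refine ⟨n₀.toNat, fun n hn => ?_⟩
    have := (hn₀ n (by omega) (by omega)).2
    rw [← int_div_lt_iff hR] at this
    exact this.le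

/-! ## Registered form -/

omit [FirstOrder.Ring.CompatibleRing ℤ] in
/-- Registered helper stub `ringDefinable_realCut_add` of crux stmt-Schanuel-0969 (line kernel-arithmetic-selection, S8‴):
**the sum of two families of reals with ring-definable strict lower rational cuts has a ring-definable strict lower rational
cut** (rational-cut arithmetic inside first-order arithmetic over `ℤ`). [folklore] -/
theorem ringDefinable_realCut_add : ∀ [FirstOrder.Ring.CompatibleRing ℤ] (k : ℕ) (f g : (Fin k → ℤ) → ℝ), (∅ : Set ℤ).Definable FirstOrder.Language.ring {w : Fin k ⊕ Fin 2 → ℤ | 0 < w (Sum.inr 1) ∧ ((w (Sum.inr 0) : ℤ) : ℝ) < ((w (Sum.inr 1) : ℤ) : ℝ) * f (fun s => w (Sum.inl s))} → (∅ : Set ℤ).Definable FirstOrder.Language.ring {w : Fin k ⊕ Fin 2 → ℤ | 0 < w (Sum.inr 1) ∧ ((w (Sum.inr 0) : ℤ) : ℝ) < ((w (Sum.inr 1) : ℤ) : ℝ) * g (fun s => w (Sum.inl s))} → (∅ : Set ℤ).Definable FirstOrder.Language.ring {w : Fin k ⊕ Fin 2 → ℤ | 0 < w (Sum.inr 1)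 ∧ ((w (Sum.inr 0) : ℤ) : ℝ) < ((w (Sum.inr 1) : ℤ) : ℝ) * (f (fun s => w (Sum.inl s)) + g (fun s => w (Sum.inl s)))} := by
  intro _ k f g hf hg
  exact defR_add hf hg

end Summit.Schanuel.Schanuel.Cruxes.MinimalCounterexampleInAcl.KernelArithmeticSelection
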